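import Summits.Ventures.HodgeRepro2.T5AveragedProjection
import Summits.Ventures.HodgeRepro2.T5AbelianWeights
import Summits.Ventures.HodgeRepro2.T5IsotypicCopies

/-!
# Restriction to a closed subgroup: K-types

Blind cell `pub-hodge-repro2`, seat p1 (gen 12), Tier-5 kernel support for the «K-type decomposition»
sentences of `route/T5-SUPPORT-p1.md` §S4.7 (P2′: a representation restricted to the compact subgroup
`K_W ∩ H_j¹ = SO(2)` decomposes into weights).

For a representation `π` of a topological group `G` and a subgroup `K`, `restrictToSubgroup K π` is the
restriction `π ∘ K.subtype`.  When `G` is compact and `K` is closed, `K` is a compact group and the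
whole Schur / isotypic machinery of gen 11–12 applies to the restriction:

* `continuous_restrictToSubgroup`, `character_restrictToSubgroup` (the character restricts),
  `isStable_restrictToSubgroup` (a `π`-stable subspace is `K`-stable);
* `compactSpace_of_isClosed` — a closed subgroup of a compact group is a compact group;
* **`exists_isInternal_irreducible_restrict`** — the **K-type decomposition**: `V` is an internal
  direct sum of `K`-irreducible stable subspaces (no unitarity);
* **`exists_decomposition_finrank_eq_one_restrict`** — for ABELIAN `K` (e.g. `SO(2)`), `V` is an
  internal direct sum of `K`-stable lines, each carrying a continuous unimodular character of `K`
  (the weight, `T5AbelianWeights.weight`).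

Honest scope (unchanged): compact groups and finite-dimensional `V`; the K-types of the
infinite-dimensional π₃⁺ are not an instance.
-/

namespace Summit.Ventures.HodgeRepro2.T5SubgroupRestriction

open MeasureTheory T5SchurOrthogonality T5CompleteReducibility

variable {G : Type*} [Group G] [TopologicalSpace G] [IsTopologicalGroup G]
variable {V : Type*} [NormedAddCommGroup V] [InnerProductSpace ℂ V]
variable (K : Subgroup G) (π : G →* V →L[ℂ] V)

/-- The restriction of `π` to the subgroup `K`. -/
def restrictToSubgroup : K →* V →L[ℂ] V := π.comp K.subtype

omit [TopologicalSpace G] [IsTopologicalGroup G] in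
/-- `restrictToSubgroup K π k = π k`. -/
theorem restrictToSubgroup_apply (k : K) : restrictToSubgroup K π k = π k := rfl

omit [IsTopologicalGroup G] in
/-- The restriction of a continuous representation is continuous. -/
theorem continuous_restrictToSubgroup (hπ : Continuous π) : Continuous (restrictToSubgroup K π) :=
  hπ.comp continuous_subtype_val

omit [TopologicalSpace G] [IsTopologicalGroup G] in
/-- The character of the restriction is the restriction of the character. -/
theorem character_restrictToSubgroup (k : K) :
    character (restrictToSubgroup K π) k = character π k := rfl

omit [TopologicalSpace G] [IsTopologicalGroup G] in
/-- A `π`-stable subspace is stable under the restriction to `K`. -/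
theorem isStable_restrictToSubgroup {W : Submodule ℂ V} (hW : IsStable π W) :
    IsStable (restrictToSubgroup K π) W :=
  fun k x hx => hW k x hx

omit [IsTopologicalGroup G] in
/-- A closed subgroup of a compact group is compact. -/
theorem compactSpace_of_isClosed [CompactSpace G] (hK : IsClosed (K : Set G)) : CompactSpace K :=
  isCompact_iff_compactSpace.mp hK.isCompact

section compact

variable [MeasurableSpace G] [BorelSpace G] [CompactSpace G] [T2Space G]
variable [FiniteDimensional ℂ V]

/-- **The K-type decomposition**: for a closed subgroup `K` of a compact Hausdorff group `G` and a
continuous finite-dimensional representation `π`, `V` is an internal direct sum of `K`-irreducible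
stable subspaces (the averaged-projection decomposition of the compact group `K`; no unitarity). -/
theorem exists_isInternal_irreducible_restrict (hK : IsClosed (K : Set G)) (hπ : Continuous π) :
    ∃ S : Finset (Submodule ℂ V),
      (∀ W ∈ S, IsIrreducibleSubspace (restrictToSubgroup K π) W) ∧
        DirectSum.IsInternal (fun W : S => (W : Submodule ℂ V)) := by
  haveI : CompactSpace K := compactSpace_of_isClosed K hK
  exact T5AveragedProjection.exists_isInternal_irreducible_of_compact (restrictToSubgroup K π)
    (continuous_restrictToSubgroup K π hπ)

/-- **Weights of an abelian closed subgroup**: for ABELIAN `K` (e.g. `SO(2)`), `V` is an internal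
direct sum of `K`-stable lines. -/
theorem exists_decomposition_finrank_eq_one_restrict [IsMulCommutative K] (hK : IsClosed (K : Set G))
    (hπ : Continuous π) :
    ∃ S : Finset (Submodule ℂ V),
      (∀ W ∈ S, IsIrreducibleSubspace (restrictToSubgroup K π) W ∧ Module.finrank ℂ W = 1) ∧
        DirectSum.IsInternal (fun W : S => (W : Submodule ℂ V)) := by
  haveI : CompactSpace K := compactSpace_of_isClosed K hK
  exact T5AbelianWeights.exists_decomposition_finrank_eq_one (restrictToSubgroup K π)
    (T5SchurMathlib.haarProb K) (continuous_restrictToSubgroup K π hπ)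

omit [IsTopologicalGroup G] [MeasurableSpace G] [BorelSpace G] [CompactSpace G] [T2Space G]
  [FiniteDimensional ℂ V] in
/-- On a `K`-stable line spanned by `w ≠ 0`, `π k w = weight k • w` with a continuous weight
`K → ℂ` (`T5AbelianWeights.weight` of the restriction). -/
theorem exists_weight_of_line (hπ : Continuous π) {W : Submodule ℂ V}
    (hW : IsStable (restrictToSubgroup K π) W) (h1 : Module.finrank ℂ W = 1) {w : V} (hw : w ∈ W)
    (hw0 : w ≠ 0) :
    ∃ χ : K → ℂ, Continuous χ ∧ ∀ k : K, π k w = χ k • w :=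
  ⟨T5AbelianWeights.weight (restrictToSubgroup K π) hW h1 hw hw0,
    T5AbelianWeights.continuous_weight _ hW h1 hw hw0 (continuous_restrictToSubgroup K π hπ),
    fun k => T5AbelianWeights.weight_spec (restrictToSubgroup K π) hW h1 hw hw0 k⟩

end compact

end Summit.Ventures.HodgeRepro2.T5SubgroupRestriction
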